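import Mathlib
import Summits.QuantumFields.YangMills.Theorems.BalabanUVNodesN15BackgroundTupleCalculus
import Summits.QuantumFields.YangMills.Theorems.BalabanUVNodesN15BackgroundSiteWords
import Literature.MathematicalPhysics.QuantumFieldTheory.Balaban1983to89.B9Eq3130MatrixLetters
import HarnessLib

/-!
# Route «BalabanUVNodes» (K4 «SpineRates»), node N15 = NE2, BACKGROUND LAYER — THE DRESSED ENTRY 2 BY PARTS: `E₂ = B̂∘(1 + K̂)⁻¹` on the tuple carrier, its Neumann
# majorant, its η-DEFECT from the letters `{B̂′, 𝔇(B̂′,B̂), K_μ, K′_μ, 𝔇(K′_μ,K_μ)}`, and the IDENTIFICATION `E₀∘∇_ν* = E₂∘ι_ν` — NO MIXED PIECE `∇_μG∇_ν*` ANYWHERE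

Cell `pub-ymgap`, seat `pub-ymgap-dag-n15-c` (generation g8; R134 ACCELERATION SEAT, strategy s1; HUMAN RULING D-0062; chair R424 venue; `bears_on: R4∕N15`).  Filed
`--kind proof --supports stmt-QuantumFields-20509 --as helper` (K3⁶; count-neutral).  Imports BY NAME this seat's `…N15BackgroundTupleCalculus` (the tuple carrier, the product
rules, the closed system `sumJ_e2_comp_addId`), this seat's S1∕S2 `…N15BackgroundSiteNeumann`∕`…SiteWords` (`siteInv`, `comp_siteInv`, `siteInv_comp`, `isUnit_stepE`,
`hasMaj_siteInv`, `hasMaj_add_exp`; through them n15-b B1a `bgPropV`) and [B6]'s `B9Eq3130MatrixLetters.hasMaj_id_ofBlocks`; nothing in the tree is modified.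

WHY.  See the header of `…N15BackgroundTupleCalculus`: the lineage's left-Neumann entry 2 needs a uniform sup-block letter for the mixed pieces `∇_μG∇_ν*`, false for Bałaban's
full `U ≡ 1` propagator ([B4-I] (1.112)–(1.113) p.36, [B9] (3.44) p.398: Hölder source norm); the print's right form (3.64)–(3.65) p.402 plus integration by parts closes
entry 2 on the letters {dressed entry 0, `U ≡ 1` entry 2 `G∇*`, one-step shifts, coefficient multiplications}.  THIS FILE inverts the resulting `1 + K̂` by the lineage's
Neumann device (S1 `siteInv 1 1 (1 + K̂)` = n15-b `bgPropV 1 (−K̂)`), bounds `E₂ = B̂∘(1 + K̂)⁻¹` and its η-defect by Leibniz + the EXACT INVERSE RULE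
`𝔇((1+K̂′)⁻¹, (1+K̂)⁻¹) = −(1+K̂′)⁻¹∘stack_μ𝔇(K′_μ,K_μ)∘(1+K̂)⁻¹` (`T4EtaRateDefect.idef_inv`, transports `pull (liftMap π J)` ∕ `pull π`), and proves that the object IS the dressed
propagator composed with `∇_ν*` (`e0_comp_fgradAdj_eq_e2ByParts`).  The letters of the rows `K_μ = K̃_μ∘Σ_νS_νpr_ν` and of `B̂ = (1 + E₀R̃)∘Σ_νS_νpr_ν` on the torus family (shift
cost `e^{σ}`, the shift-defect device of this seat's W1 on the Hölder steps of `G∇*` = [B4-I] (1.111) tensor clause, dag-n15-a part 66; `𝔇(S′_ν, S_ν)` = dag-n15-a's entry 2) are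
the sequel's — here they are DISPLAYED hypotheses of the two ★ theorems.

CONTENTS ([folklore] bookkeeping; 3 defs).
* §1 `e2Inv K := siteInv 1 1 (1 + stack K)`, `e2ByParts B̂ K := B̂ ∘ e2Inv K`, `E2Unit` (the unit hypothesis); `comp_e2Inv` ∕ `e2Inv_comp` (two-sided inverse), `idef_id_id_zero`,
  ★ `idef_e2Inv` (exact inverse rule), `hasMaj_addId_sub_id` ∕ `hasMaj_id_sub_addId`, `e2Unit_of_small` (`q = Rc_r² < 1`), `hasMaj_e2Inv` (`≤ (1−q)⁻¹e^{−ρd}`, `ρ + 2σ ≤ δ`),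
  ★ `hasMaj_e2ByParts`, ★★ **`hasMaj_idef_e2ByParts`** (`≤ (B·A·m_K·A·c_r³ + m_B·A·c_r)·e^{−ρd}`, `A = (1−q)⁻¹`, `ρ + 4σ ≤ δ`; rate-small letters `m_B`, `m_K` only).
* §2 ★★ **`e0_comp_fgradAdj_eq_e2ByParts`**: under `E₀ = G + E₀W` (right (3.65)) and the unit hypothesis, `E₀∘∇_ν* = e2ByParts B̂ K̂ ∘ ι_ν` — the honesty certificate.

HONEST FRAMING ∕ LIMITS.  MECHANISM + bookkeeping over hypothesis-shaped letters on an abstract [B6] carrier ((2.54), `d ≥ 0`, `d(y,y) = 0`, (2.61) at `σ`); the species is the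
print's first-order shape with ABSTRACT coefficients; nothing about Bałaban's `G(U)` asserted; the torus instantiation at `gOp` (modulo dag-n15-a's entry 2) is the next file.
NE2⁺ NOT PRINTED, NOT proved, not claimed; count-neutral (typed 28∕28 · discharged 5∕27 of record unchanged); N15 NOT discharged; one finite lattice at fixed ε — NOT ℝ⁴, NOT
infinite volume, NOT OS, NOT a mass gap, NOT Clay.
-/

noncomputable section

open scoped BigOperators
open Finset

namespace Summit.QuantumFields.YangMills.BalabanUVNodes.N15.BackgroundLayer

open Literature.MathematicalPhysics.QuantumFieldTheory.Balaban1983to89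
open Literature.MathematicalPhysics.QuantumFieldTheory.Balaban1983to89.B11SectG (BlockNorm HasMaj RowSum hasMaj_comp hasMaj_comp_exp)
open Literature.MathematicalPhysics.QuantumFieldTheory.Balaban1983to89.T4EtaRateDefect (idef idef_apply idef_comp idef_add idef_inv)
open Literature.MathematicalPhysics.QuantumFieldTheory.Balaban1983to89.T4EtaRateCoeffDefect (pull pull_apply diagK diagK_nonneg)
open Literature.MathematicalPhysics.QuantumFieldTheory.Balaban1983to89.B6RandomWalk (Triangle254)
open Literature.MathematicalPhysics.QuantumFieldTheory.Balaban1983to89.B6Prop26Gluing (mulOp mulOp_apply)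
open Literature.MathematicalPhysics.QuantumFieldTheory.Balaban1983to89.B11AxialTransport190 (abs_le_loc_ofBlocks loc_ofBlocks_le)
open Literature.MathematicalPhysics.QuantumFieldTheory.Balaban1983to89.B9Eq3130MatrixLetters (hasMaj_id_ofBlocks)
open Summit.QuantumFields.YangMills.BalabanUVNodes.N15.MatrixSpecies (liftMap liftBlk)
open Summit.QuantumFields.YangMills.BalabanUVNodes.N15.BackgroundModel (kappa_ofBlocks)
open Summit.QuantumFields.YangMills.BalabanUVNodes.N15.SiteLayer (siteInv comp_siteInv siteInv_comp hasMaj_siteInv isUnit_stepE hasMaj_add_exp)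

/-! ## §1 The entry-2 device: `E₂ = B̂ ∘ (1 + K̂)⁻¹` on the tuple carrier — unit, inverse identities, exact inverse rule, majorants, η-defect -/

section Device

variable {X X' J : Type} [Fintype X] [Fintype X'] [Fintype J] [DecidableEq X] [DecidableEq X'] [DecidableEq J]

/-- THE RIGHT NEUMANN INVERSE `(1 + K̂)⁻¹` on the tuple carrier `X × J → ℝ`, `K̂ = stack_μ K_μ` for rows `K_μ : (X × J → ℝ) → (X → ℝ)` — this seat's S1 Neumann
object `siteInv 1 1 (1 + K̂) = bgPropV 1 (−K̂)` (n15-b B1a). [cite: Balaban1985BackgroundPropagators, (3.64) p.402 («the inverse is given by a convergent Neumann series»: mechanism)] -/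
def e2Inv (Krow : J → ((X × J → ℝ) →ₗ[ℝ] (X → ℝ))) : (X × J → ℝ) →ₗ[ℝ] (X × J → ℝ) :=
  siteInv LinearMap.id LinearMap.id (LinearMap.id + stackJ Krow)

/-- THE ENTRY-2 OBJECT BY PARTS: `E₂ = B̂ ∘ (1 + K̂)⁻¹ : (X × J → ℝ) → (X → ℝ)` for a source operator `B̂` and rows `K_μ`. [cite: Balaban1985BackgroundPropagators, (3.64)–(3.65) p.402 (mechanism: right Neumann form)] -/
def e2ByParts (Bop : (X × J → ℝ) →ₗ[ℝ] (X → ℝ)) (Krow : J → ((X × J → ℝ) →ₗ[ℝ] (X → ℝ))) : (X × J → ℝ) →ₗ[ℝ] (X → ℝ) :=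
  Bop ∘ₗ e2Inv Krow

/-- The unit hypothesis of the Neumann object (S1's, at `W = 1`, `K₀ = 1`, `K = 1 + K̂`). [folklore] -/
def E2Unit (Krow : J → ((X × J → ℝ) →ₗ[ℝ] (X → ℝ))) : Prop :=
  IsUnit (1 - LinearMap.toMatrix' ((LinearMap.id : (X × J → ℝ) →ₗ[ℝ] (X × J → ℝ)) ∘ₗ (LinearMap.id - (LinearMap.id + stackJ Krow))))

/-- `(1 + K̂) ∘ (1 + K̂)⁻¹ = 1` under the unit hypothesis. [folklore] -/
theorem comp_e2Inv {Krow : J → ((X × J → ℝ) →ₗ[ℝ] (X → ℝ))} (hunit : E2Unit Krow) :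
    (LinearMap.id + stackJ Krow) ∘ₗ e2Inv Krow = LinearMap.id :=
  comp_siteInv hunit (LinearMap.id_comp _)

/-- `(1 + K̂)⁻¹ ∘ (1 + K̂) = 1` under the unit hypothesis. [folklore] -/
theorem e2Inv_comp {Krow : J → ((X × J → ℝ) →ₗ[ℝ] (X → ℝ))} (hunit : E2Unit Krow) :
    e2Inv Krow ∘ₗ (LinearMap.id + stackJ Krow) = LinearMap.id :=
  siteInv_comp hunit (LinearMap.id_comp _)

omit [Fintype X'] [DecidableEq X'] in
/-- The identities have no η-defect through a common transport: `𝔇(1′, 1) = τ − τ = 0`. [folklore] -/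
theorem idef_id_id_zero {F F' : Type} [AddCommGroup F] [Module ℝ F] [AddCommGroup F'] [Module ℝ F'] (τ : F →ₗ[ℝ] F') :
    idef τ τ LinearMap.id LinearMap.id = 0 := by
  refine LinearMap.ext fun v => ?_
  rw [idef_apply, LinearMap.id_apply, LinearMap.id_apply, sub_self, LinearMap.zero_apply]

/-- **THE EXACT INVERSE RULE for `(1 + K̂)⁻¹`** through the tuple transport `pull (liftMap π J)`: `𝔇((1 + K̂′)⁻¹, (1 + K̂)⁻¹) = −(1 + K̂′)⁻¹ ∘ stack_μ 𝔇(K′_μ, K_μ) ∘ (1 + K̂)⁻¹`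
(`T4EtaRateDefect.idef_inv`; rate = stability × consistency). [folklore] -/
theorem idef_e2Inv (π : X' → X) {Krow' : J → ((X' × J → ℝ) →ₗ[ℝ] (X' → ℝ))} {Krow : J → ((X × J → ℝ) →ₗ[ℝ] (X → ℝ))}
    (hunit' : E2Unit Krow') (hunit : E2Unit Krow) :
    idef (pull (liftMap π J)) (pull (liftMap π J)) (e2Inv Krow') (e2Inv Krow) =
      -(e2Inv Krow' ∘ₗ stackJ (fun μ => idef (pull (liftMap π J)) (pull π) (Krow' μ) (Krow μ)) ∘ₗ e2Inv Krow) := by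
  rw [idef_inv (τ₁ := pull (liftMap π J)) (τ₂ := pull (liftMap π J)) (e2Inv_comp hunit') (comp_e2Inv hunit), idef_add, idef_id_id_zero, zero_add,
    idef_stackJ]

variable {g : B6.Geometry} (blk : X → g.Site) (π : X' → X) {σ cr : ℝ}

omit [Fintype X'] [DecidableEq X] [DecidableEq X'] [DecidableEq J] in
/-- `(1 + K̂) − 1 = K̂` keeps the stack's majorant. [folklore] -/
theorem hasMaj_addId_sub_id {Krow : J → ((X × J → ℝ) →ₗ[ℝ] (X → ℝ))} {R δ : ℝ} (hR : 0 ≤ R)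
    (hK : ∀ μ, HasMaj (BlockNorm.ofBlocks g (liftBlk blk J)) (BlockNorm.ofBlocks g blk) (Krow μ) (fun y y' => R * Real.exp (-(δ * g.dist y y')))) :
    HasMaj (BlockNorm.ofBlocks g (liftBlk blk J)) (BlockNorm.ofBlocks g (liftBlk blk J)) ((LinearMap.id + stackJ Krow) - LinearMap.id)
      (fun y y' => R * Real.exp (-(δ * g.dist y y'))) :=
  (hasMaj_stackJ blk (fun _ _ => mul_nonneg hR (Real.exp_nonneg _)) hK).congr fun u => by rw [add_sub_cancel_left]

omit [Fintype X'] [DecidableEq X] [DecidableEq X'] [DecidableEq J] in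
/-- `1 − (1 + K̂) = −K̂` keeps the stack's majorant. [folklore] -/
theorem hasMaj_id_sub_addId {Krow : J → ((X × J → ℝ) →ₗ[ℝ] (X → ℝ))} {R δ : ℝ} (hR : 0 ≤ R)
    (hK : ∀ μ, HasMaj (BlockNorm.ofBlocks g (liftBlk blk J)) (BlockNorm.ofBlocks g blk) (Krow μ) (fun y y' => R * Real.exp (-(δ * g.dist y y')))) :
    HasMaj (BlockNorm.ofBlocks g (liftBlk blk J)) (BlockNorm.ofBlocks g (liftBlk blk J)) (LinearMap.id - (LinearMap.id + stackJ Krow))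
      (fun y y' => R * Real.exp (-(δ * g.dist y y'))) :=
  (hasMaj_stackJ blk (fun _ _ => mul_nonneg hR (Real.exp_nonneg _)) hK).neg.congr fun u => by
    rw [LinearMap.neg_apply, LinearMap.sub_apply, LinearMap.add_apply, LinearMap.id_apply, sub_add_cancel_left]

omit [Fintype X'] [DecidableEq X'] in
/-- **THE UNIT**: `1 + K̂` is invertible when the rows obey `K_μ ≤ R·e^{−δd}` with `q := R·c_r² < 1` ((2.61) row sum at `σ`, `0 ≤ σ ≤ δ`, `d(y, y) = 0`).
[cite: Balaban1985BackgroundPropagators, (3.64) p.402 (mechanism: «I − V′(A)G′(U) is an invertible operator»)] -/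
theorem e2Unit_of_small (htri : Triangle254 g) (hd : ∀ a b : g.Site, 0 ≤ g.dist a b) (hd0 : ∀ y : g.Site, g.dist y y = 0) (hrow : RowSum g σ cr)
    (hσ : 0 ≤ σ) (hcr : 0 ≤ cr) {Krow : J → ((X × J → ℝ) →ₗ[ℝ] (X → ℝ))} {R δ : ℝ} (hR : 0 ≤ R) (hσδ : σ ≤ δ)
    (hK : ∀ μ, HasMaj (BlockNorm.ofBlocks g (liftBlk blk J)) (BlockNorm.ofBlocks g blk) (Krow μ) (fun y y' => R * Real.exp (-(δ * g.dist y y'))))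
    (hq : 1 * R * cr * cr < 1) : E2Unit Krow :=
  isUnit_stepE (liftBlk blk J) htri hd hrow hσ zero_le_one hR hcr (ρ₁ := δ) (δW := δ + σ) hσδ le_rfl le_rfl
    (hasMaj_id_ofBlocks (liftBlk blk J) hd0 (δ + σ)) (hasMaj_id_sub_addId blk hR hK) hq

omit [Fintype X'] [DecidableEq X'] in
/-- **NEUMANN WITH DECAY for `(1 + K̂)⁻¹`**: `≤ (1 − q)⁻¹·e^{−ρd}`, `q = R·c_r²`, for `0 ≤ ρ`, `ρ + 2σ ≤ δ`. [cite: Balaban1985BackgroundPropagators, (3.64) p.402 (mechanism); Balaban1984PropagatorsII, (2.52)–(2.56) pp.232–233] -/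
theorem hasMaj_e2Inv (htri : Triangle254 g) (hd : ∀ a b : g.Site, 0 ≤ g.dist a b) (hd0 : ∀ y : g.Site, g.dist y y = 0) (hrow : RowSum g σ cr)
    (hσ : 0 ≤ σ) (hcr : 0 ≤ cr) {Krow : J → ((X × J → ℝ) →ₗ[ℝ] (X → ℝ))} {R δ ρ : ℝ} (hR : 0 ≤ R) (hρ : 0 ≤ ρ) (hρδ : ρ + 2 * σ ≤ δ)
    (hK : ∀ μ, HasMaj (BlockNorm.ofBlocks g (liftBlk blk J)) (BlockNorm.ofBlocks g blk) (Krow μ) (fun y y' => R * Real.exp (-(δ * g.dist y y'))))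
    (hq : 1 * R * cr * cr < 1) :
    HasMaj (BlockNorm.ofBlocks g (liftBlk blk J)) (BlockNorm.ofBlocks g (liftBlk blk J)) (e2Inv Krow)
      (fun y y' => 1 * (1 - 1 * R * cr * cr)⁻¹ * Real.exp (-(ρ * g.dist y y'))) :=
  hasMaj_siteInv (liftBlk blk J) htri hd hrow hσ hcr zero_le_one hR hρ hρδ (hasMaj_id_ofBlocks (liftBlk blk J) hd0 δ) (hasMaj_addId_sub_id blk hR hK) hq

omit [Fintype X'] [DecidableEq X'] in
/-- **THE MAJORANT OF THE ENTRY-2 OBJECT**: `B̂ ≤ B·e^{−δd}`, rows `≤ R·e^{−δd}`, `q = Rc_r² < 1`, `ρ + 3σ ≤ δ` ⇒ `E₂ ≤ B·(1 − q)⁻¹·c_r·e^{−ρd}`. [cite: Balaban1985BackgroundPropagators, Thm 3.1 (3.42) p.397 (entry «G(U)∇*» : shape) + (3.64)–(3.65) p.402 (mechanism)] -/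
theorem hasMaj_e2ByParts (htri : Triangle254 g) (hd : ∀ a b : g.Site, 0 ≤ g.dist a b) (hd0 : ∀ y : g.Site, g.dist y y = 0) (hrow : RowSum g σ cr)
    (hσ : 0 ≤ σ) (hcr : 0 ≤ cr) {Bop : (X × J → ℝ) →ₗ[ℝ] (X → ℝ)} {Krow : J → ((X × J → ℝ) →ₗ[ℝ] (X → ℝ))} {B R δ ρ : ℝ} (hB : 0 ≤ B) (hR : 0 ≤ R)
    (hρ : 0 ≤ ρ) (hρδ : ρ + 3 * σ ≤ δ)
    (hBop : HasMaj (BlockNorm.ofBlocks g (liftBlk blk J)) (BlockNorm.ofBlocks g blk) Bop (fun y y' => B * Real.exp (-(δ * g.dist y y'))))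
    (hK : ∀ μ, HasMaj (BlockNorm.ofBlocks g (liftBlk blk J)) (BlockNorm.ofBlocks g blk) (Krow μ) (fun y y' => R * Real.exp (-(δ * g.dist y y'))))
    (hq : 1 * R * cr * cr < 1) :
    HasMaj (BlockNorm.ofBlocks g (liftBlk blk J)) (BlockNorm.ofBlocks g blk) (e2ByParts Bop Krow)
      (fun y y' => B * (1 * (1 - 1 * R * cr * cr)⁻¹) * cr * Real.exp (-(ρ * g.dist y y'))) := by
  have hq' : 0 < 1 - 1 * R * cr * cr := by linarith
  have hA : 0 ≤ 1 * (1 - 1 * R * cr * cr)⁻¹ := mul_nonneg zero_le_one (inv_nonneg.2 hq'.le)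
  have hInv := hasMaj_e2Inv blk htri hd hd0 hrow hσ hcr hR (ρ := ρ + σ) (by linarith) (by linarith) hK hq
  have key := hasMaj_comp_exp (b₁ := BlockNorm.ofBlocks g (liftBlk blk J)) (b₂ := BlockNorm.ofBlocks g (liftBlk blk J)) (b₃ := BlockNorm.ofBlocks g blk)
    (ρ := ρ) htri hd hrow hB hA hρ (by linarith) (by linarith) hBop hInv
  refine key.mono fun a b => le_of_eq ?_
  rw [kappa_ofBlocks]
  ring

/-- **THE η-DEFECT OF THE ENTRY-2 OBJECT** from letters at one rate `δ`: `B̂′ ≤ B·e^{−δd}`, `𝔇(B̂′, B̂) ≤ m_B·e^{−δd}`, rows `K_μ, K′_μ ≤ R·e^{−δd}`,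
row defects `𝔇(K′_μ, K_μ) ≤ m_K·e^{−δd}` (through `pull (liftMap π J)`, `pull π`), `q = Rc_r² < 1`, `ρ + 4σ ≤ δ`:
`𝔇(E₂′, E₂) = B̂′∘𝔇((1+K̂′)⁻¹, (1+K̂)⁻¹) + 𝔇(B̂′, B̂)∘(1+K̂)⁻¹ ≤ (B·A·m_K·A·c_r³ + m_B·A·c_r)·e^{−ρd}`, `A = (1 − q)⁻¹` — Leibniz + the exact inverse rule; the
rate-small letters are `m_B`, `m_K` only. [cite: Balaban1985BackgroundPropagators, (3.64)–(3.65) p.402 (mechanism); Balaban1984PropagatorsII, (2.52)–(2.56) pp.232–233, Lemma 2.1 (2.61) p.234] -/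
theorem hasMaj_idef_e2ByParts (htri : Triangle254 g) (hd : ∀ a b : g.Site, 0 ≤ g.dist a b) (hd0 : ∀ y : g.Site, g.dist y y = 0) (hrow : RowSum g σ cr)
    (hσ : 0 ≤ σ) (hcr : 0 ≤ cr) {Bop : (X × J → ℝ) →ₗ[ℝ] (X → ℝ)} {Krow : J → ((X × J → ℝ) →ₗ[ℝ] (X → ℝ))}
    {Bop' : (X' × J → ℝ) →ₗ[ℝ] (X' → ℝ)} {Krow' : J → ((X' × J → ℝ) →ₗ[ℝ] (X' → ℝ))} {B R mB mK δ ρ : ℝ} (hB : 0 ≤ B) (hR : 0 ≤ R)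
    (hmB : 0 ≤ mB) (hmK : 0 ≤ mK) (hρ : 0 ≤ ρ) (hρδ : ρ + 4 * σ ≤ δ)
    (hBop' : HasMaj (BlockNorm.ofBlocks g (liftBlk (blk ∘ π) J)) (BlockNorm.ofBlocks g (blk ∘ π)) Bop' (fun y y' => B * Real.exp (-(δ * g.dist y y'))))
    (hDB : HasMaj (BlockNorm.ofBlocks g (liftBlk blk J)) (BlockNorm.ofBlocks g (blk ∘ π)) (idef (pull (liftMap π J)) (pull π) Bop' Bop)
      (fun y y' => mB * Real.exp (-(δ * g.dist y y'))))
    (hK : ∀ μ, HasMaj (BlockNorm.ofBlocks g (liftBlk blk J)) (BlockNorm.ofBlocks g blk) (Krow μ) (fun y y' => R * Real.exp (-(δ * g.dist y y'))))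
    (hK' : ∀ μ, HasMaj (BlockNorm.ofBlocks g (liftBlk (blk ∘ π) J)) (BlockNorm.ofBlocks g (blk ∘ π)) (Krow' μ) (fun y y' => R * Real.exp (-(δ * g.dist y y'))))
    (hDK : ∀ μ, HasMaj (BlockNorm.ofBlocks g (liftBlk blk J)) (BlockNorm.ofBlocks g (blk ∘ π)) (idef (pull (liftMap π J)) (pull π) (Krow' μ) (Krow μ))
      (fun y y' => mK * Real.exp (-(δ * g.dist y y'))))
    (hq : 1 * R * cr * cr < 1) :
    HasMaj (BlockNorm.ofBlocks g (liftBlk blk J)) (BlockNorm.ofBlocks g (blk ∘ π))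
      (idef (pull (liftMap π J)) (pull π) (e2ByParts Bop' Krow') (e2ByParts Bop Krow))
      (fun y y' => (B * (1 * (1 - 1 * R * cr * cr)⁻¹) * mK * cr * (1 * (1 - 1 * R * cr * cr)⁻¹) * cr * cr +
        mB * (1 * (1 - 1 * R * cr * cr)⁻¹) * cr) * Real.exp (-(ρ * g.dist y y'))) := by
  have hq' : 0 < 1 - 1 * R * cr * cr := by linarith
  have hA : 0 ≤ 1 * (1 - 1 * R * cr * cr)⁻¹ := mul_nonneg zero_le_one (inv_nonneg.2 hq'.le)
  have hσδ : σ ≤ δ := by linarith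
  -- units on both lattices
  have hunit : E2Unit Krow := e2Unit_of_small blk htri hd hd0 hrow hσ hcr hR hσδ hK hq
  have hunit' : E2Unit Krow' := e2Unit_of_small (blk ∘ π) htri hd hd0 hrow hσ hcr hR hσδ hK' hq
  -- the two inverses, at rate `ρ + 2σ`
  have hInv := hasMaj_e2Inv blk htri hd hd0 hrow hσ hcr hR (ρ := ρ + 2 * σ) (by linarith) (by linarith) hK hq
  have hInv' := hasMaj_e2Inv (blk ∘ π) htri hd hd0 hrow hσ hcr hR (ρ := ρ + 2 * σ) (by linarith) (by linarith) hK' hq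
  -- Leibniz
  rw [e2ByParts, e2ByParts, idef_comp (pull (liftMap π J)) (pull (liftMap π J)) (pull π), idef_e2Inv π hunit' hunit]
  refine hasMaj_add_exp ?_ ?_
  · -- `B̂′ ∘ (−(1+K̂′)⁻¹ ∘ stack 𝔇K ∘ (1+K̂)⁻¹)`
    have hSDK : HasMaj (BlockNorm.ofBlocks g (liftBlk blk J)) (BlockNorm.ofBlocks g (liftBlk (blk ∘ π) J))
        (stackJ fun μ => idef (pull (liftMap π J)) (pull π) (Krow' μ) (Krow μ)) (fun y y' => mK * Real.exp (-(δ * g.dist y y'))) :=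
      hasMaj_stackJ (blk ∘ π) (fun _ _ => mul_nonneg hmK (Real.exp_nonneg _)) hDK
    have h1 := hasMaj_comp_exp (b₁ := BlockNorm.ofBlocks g (liftBlk blk J)) (b₂ := BlockNorm.ofBlocks g (liftBlk blk J))
      (b₃ := BlockNorm.ofBlocks g (liftBlk (blk ∘ π) J)) (ρ := ρ + σ) htri hd hrow hmK hA (by linarith) (by linarith) (by linarith) hSDK hInv
    have h2 := hasMaj_comp_exp (b₁ := BlockNorm.ofBlocks g (liftBlk blk J)) (b₂ := BlockNorm.ofBlocks g (liftBlk (blk ∘ π) J))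
      (b₃ := BlockNorm.ofBlocks g (liftBlk (blk ∘ π) J)) (ρ := ρ + σ) htri hd hrow hA
      (mul_nonneg (mul_nonneg (mul_nonneg ((BlockNorm.ofBlocks g (liftBlk blk J)).κ_nonneg) hmK) hA) hcr) (by linarith) le_rfl (by linarith) hInv' h1
    have h3 := hasMaj_comp_exp (b₁ := BlockNorm.ofBlocks g (liftBlk blk J)) (b₂ := BlockNorm.ofBlocks g (liftBlk (blk ∘ π) J))
      (b₃ := BlockNorm.ofBlocks g (blk ∘ π)) (ρ := ρ) htri hd hrow hB
      (mul_nonneg (mul_nonneg (mul_nonneg ((BlockNorm.ofBlocks g (liftBlk (blk ∘ π) J)).κ_nonneg) hA)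
        (mul_nonneg (mul_nonneg (mul_nonneg ((BlockNorm.ofBlocks g (liftBlk blk J)).κ_nonneg) hmK) hA) hcr)) hcr) hρ (by linarith) (by linarith) hBop' h2
    rw [← LinearMap.comp_assoc] at h3
    refine (h3.neg.congr fun u => ?_).mono fun a b => le_of_eq ?_
    · simp only [LinearMap.neg_apply, LinearMap.comp_apply, LinearMap.comp_neg]
    · simp only [kappa_ofBlocks]
      ring
  · -- `𝔇(B̂′, B̂) ∘ (1+K̂)⁻¹`
    have h1 := hasMaj_comp_exp (b₁ := BlockNorm.ofBlocks g (liftBlk blk J)) (b₂ := BlockNorm.ofBlocks g (liftBlk blk J))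
      (b₃ := BlockNorm.ofBlocks g (blk ∘ π)) (ρ := ρ) htri hd hrow hmB hA hρ (by linarith) (by linarith) hDB hInv
    refine h1.mono fun a b => le_of_eq ?_
    rw [kappa_ofBlocks]
    ring

end Device

/-! ## §2 IDENTIFICATION: the entry-2 object IS the dressed propagator composed with `∇_ν*` -/

section Identification

variable {X J : Type} [Fintype X] [Fintype J] [DecidableEq X] [DecidableEq J]
variable {τ : J → X ≃ X} {n : ℝ} {G E0 R₀ : (X → ℝ) →ₗ[ℝ] (X → ℝ)} {Ca Ca' Cb Cb'' : J → ((X → ℝ) →ₗ[ℝ] (X → ℝ))}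

/-- ★★ **IDENTIFICATION — THE ENTRY-2 OBJECT IS THE DRESSED PROPAGATOR COMPOSED WITH `∇_ν*`**: under the right fixed-point equation `E₀ = G + E₀W` ((3.65)), the
intertwining of the coefficient operators with the shifts, and the unit hypothesis for `1 + K̂` (`K_μ = K̃_μ ∘ Σ_νS_νpr_ν`, `S_ν = G∘∇_ν*`), the dressed entry 2 is the device's
object: `E₀ ∘ ∇_ν* = e2ByParts B̂ K̂ ∘ ι_ν` with `B̂ = Σ_νS_νpr_ν + E₀∘R̃∘Σ_νS_νpr_ν` — the honesty certificate: no mixed piece `∇_μG∇_ν*` is a letter of the right-hand side.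
[cite: Balaban1985BackgroundPropagators, (3.64)–(3.65) p.402 (mechanism); the by-parts form is ours] -/
theorem e0_comp_fgradAdj_eq_e2ByParts (hE0 : E0 = G + E0 ∘ₗ rightPert τ n G R₀ Ca Cb) (hCa : ∀ μ, Ca μ ∘ₗ pull (τ μ) = pull (τ μ) ∘ₗ Ca' μ)
    (hCb : ∀ μ, Cb μ ∘ₗ pull (τ μ).symm = pull (τ μ).symm ∘ₗ Cb'' μ)
    (hunit : E2Unit fun μ => byPartsFactor τ Ca' Cb'' μ ∘ₗ sumJ fun ν => G ∘ₗ fgradAdj n (τ ν)) (ν : J) :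
    E0 ∘ₗ fgradAdj n (τ ν) =
      e2ByParts (sumJ (fun ν => G ∘ₗ fgradAdj n (τ ν)) + E0 ∘ₗ byPartsMult n R₀ Ca Ca' Cb Cb'' ∘ₗ sumJ fun ν => G ∘ₗ fgradAdj n (τ ν))
        (fun μ => byPartsFactor τ Ca' Cb'' μ ∘ₗ sumJ fun ν => G ∘ₗ fgradAdj n (τ ν)) ∘ₗ injJ ν := by
  have hall : sumJ (fun ν => E0 ∘ₗ fgradAdj n (τ ν)) =
      e2ByParts (sumJ (fun ν => G ∘ₗ fgradAdj n (τ ν)) + E0 ∘ₗ byPartsMult n R₀ Ca Ca' Cb Cb'' ∘ₗ sumJ fun ν => G ∘ₗ fgradAdj n (τ ν))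
        (fun μ => byPartsFactor τ Ca' Cb'' μ ∘ₗ sumJ fun ν => G ∘ₗ fgradAdj n (τ ν)) := by
    rw [e2ByParts, ← sumJ_e2_comp_addId hE0 hCa hCb, LinearMap.comp_assoc, comp_e2Inv hunit, LinearMap.comp_id]
  rw [← hall, sumJ_comp_injJ]

end Identification

end Summit.QuantumFields.YangMills.BalabanUVNodes.N15.BackgroundLayer

end
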